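import Summits.Parity.BatemanHorn.Theses.IsogenyRedei
import Literature.NumberTheory.LFunctions.RHWave0PNTProofs
import Literature.NumberTheory.LFunctions.MoebiusLogHarmonicSum

/-!
# `PolyMobiusTail` (crux stmt-Parity-0870) holds on the prime-number-theorem slice `f = (X)`

Small-model fact from the cdisprove seat (refuter-cdisprove-stmt-Parity-0870-0), PROVED: for the
Bateman–Horn system `(X)` and EVERY `η ∈ (0, 1)` the crux function
`Tail_η(x) = ∑_{n ≤ x} ∑_{d ∣ n, x^{1-η} < d} μ(d) log d` is `o(x)` (`tail_X_isLittleO`), through the closed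
form `Tail_η(x) = -ψ(x) - x·∑_{d ≤ x^{1-η}} μ(d) log d/d + E(x)`, `|E(x)| ≤ x^{1-η} log x` (`tail_X_eq`,
`abs_roundingError_le`), the prime number theorem `ψ(x) ∼ x`
(`Literature.NumberTheory.LFunctions.chebyshevPsi_isEquivalent_holds`) and Landau's
`∑ μ(d) log d/d = -1` (`Literature.NumberTheory.LFunctions.tendsto_sum_moebius_mul_log_div`).
So the formalisation (strict bracket, `Int.toNat`, real exponent) behaves as intended on the one slice
where the statement is a theorem, and there the admissible `η`-range is the full open interval
(it fails at the closed endpoint `η = 1`: `Negative/CancellationAcrossN.lean`).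
-/

namespace Summit.Parity.BatemanHorn.Theorems.PolyMobiusTail.Negative

open scoped BigOperators
open Filter Asymptotics Polynomial ArithmeticFunction
open Literature.NumberTheory.Sieve

/-- Sums over `Fintype.piFinset` of a `Fin 1`-indexed family are sums over the single factor. [folklore] -/
private theorem sum_piFinset_fin_one' (t : Fin 1 → Finset ℕ) (G : ℕ → ℝ) :
    ∑ d ∈ Fintype.piFinset t, G (d 0) = ∑ j ∈ t 0, G j := by
  have h := Finset.prod_univ_sum t (fun _ j => G j)
  simp only [Fin.prod_univ_one] at h
  exact h.symm

/-- The tail of `(X)` in closed form: `-ψ(x) - x·∑_{d ≤ x^{1-η}} μ(d) log d/d + E(x)` with the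
rounding error `E(x) = ∑_{d ≤ x^{1-η}} μ(d) log d · (x/d - ⌊x/d⌋)`. [folklore] -/
theorem tail_X_eq (η : ℝ) (x : ℕ) :
    (∑ n ∈ Finset.Icc 1 x, ∑ d ∈ Fintype.piFinset (fun i => (((![(X : ℤ[X])] i).eval (n : ℤ)).toNat).divisors),
        if (x : ℝ) ^ (1 - η) < ∏ i, (d i : ℝ) then ∏ i, ((moebius (d i) : ℝ) * Real.log (d i)) else 0)
      = -Chebyshev.psi x
        - (x : ℝ) * (∑ d ∈ Finset.Ioc 0 x, if (d : ℝ) ≤ (x : ℝ) ^ (1 - η) then (moebius d : ℝ) * Real.log d / d else 0)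
        + ∑ d ∈ Finset.Ioc 0 x, (if (d : ℝ) ≤ (x : ℝ) ^ (1 - η) then (moebius d : ℝ) * Real.log d else 0)
            * ((x : ℝ) / d - ((x / d : ℕ) : ℝ)) := by
  set y : ℝ := (x : ℝ) ^ (1 - η) with hy
  -- the truncated Möbius–log weight as an arithmetic function
  set G : ArithmeticFunction ℝ := ⟨fun d => if (d : ℝ) ≤ y then (moebius d : ℝ) * Real.log d else 0, by simp⟩
    with hG
  have hGapply : ∀ d : ℕ, G d = if (d : ℝ) ≤ y then (moebius d : ℝ) * Real.log d else 0 := fun d => rfl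
  -- Step 1: one variable
  have h1 : ∀ n : ℕ, (∑ d ∈ Fintype.piFinset (fun i => (((![(X : ℤ[X])] i).eval (n : ℤ)).toNat).divisors),
        if y < ∏ i, (d i : ℝ) then ∏ i, ((moebius (d i) : ℝ) * Real.log (d i)) else 0)
      = ∑ d ∈ n.divisors, if y < (d : ℝ) then (moebius d : ℝ) * Real.log d else 0 := by
    intro n
    simp only [Fin.prod_univ_one, Matrix.cons_val_fin_one, eval_X, Int.toNat_natCast]
    exact sum_piFinset_fin_one' (fun _ => n.divisors)
      (fun j => if y < (j : ℝ) then (moebius j : ℝ) * Real.log j else 0)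
  -- Step 2: pointwise `tail_n = -Λ(n) - (G * ζ)(n)`
  have h2 : ∀ n : ℕ, (∑ d ∈ n.divisors, if y < (d : ℝ) then (moebius d : ℝ) * Real.log d else 0)
      = -vonMangoldt n - (G * ArithmeticFunction.zeta) n := by
    intro n
    rw [coe_mul_zeta_apply, ← sum_moebius_mul_log_eq, ← Finset.sum_sub_distrib]
    refine Finset.sum_congr rfl fun d _ => ?_
    rw [hGapply, ArithmeticFunction.log_apply]
    split_ifs <;> linarith
  -- Step 3: sum over `n` and swap
  have h3 : ∑ n ∈ Finset.Icc 1 x, (G * ArithmeticFunction.zeta) n = ∑ d ∈ Finset.Ioc 0 x, G d * ((x / d : ℕ) : ℝ) := by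
    rw [← sum_Ioc_mul_zeta_eq_sum G x]; rfl
  have hψ : Chebyshev.psi x = ∑ n ∈ Finset.Icc 1 x, vonMangoldt n := by
    rw [Chebyshev.psi, Nat.floor_natCast]; rfl
  simp only [h1, h2, Finset.sum_sub_distrib, Finset.sum_neg_distrib, h3, hψ, hGapply]
  rw [Finset.mul_sum]
  have : ∀ d ∈ Finset.Ioc 0 x,
      (if (d : ℝ) ≤ y then (moebius d : ℝ) * Real.log d else 0) * ((x / d : ℕ) : ℝ)
        = (x : ℝ) * (if (d : ℝ) ≤ y then (moebius d : ℝ) * Real.log d / d else 0)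
          - (if (d : ℝ) ≤ y then (moebius d : ℝ) * Real.log d else 0) * ((x : ℝ) / d - ((x / d : ℕ) : ℝ)) := by
    intro d hd
    have hd0 : (d : ℝ) ≠ 0 := by exact_mod_cast (Finset.mem_Ioc.mp hd).1.ne'
    split_ifs
    · field_simp; ring
    · simp
  rw [Finset.sum_congr rfl this, Finset.sum_sub_distrib]
  ring


/-- The truncated sum `∑_{0 < d ≤ x, d ≤ x^{1-η}} μ(d) log d / d` is the partial sum of `∑ μ(d) log d/d`
up to `⌊x^{1-η}⌋`. [folklore] -/
theorem sum_Ioc_ite_eq_sum_Icc_floor {η : ℝ} (hη : 0 ≤ η) (hη1 : η < 1) (x : ℕ) :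
    (∑ d ∈ Finset.Ioc 0 x, if (d : ℝ) ≤ (x : ℝ) ^ (1 - η) then (moebius d : ℝ) * Real.log d / d else 0)
      = ∑ d ∈ Finset.Icc 1 ⌊(x : ℝ) ^ (1 - η)⌋₊, (moebius d : ℝ) * Real.log d / d := by
  rw [← Finset.sum_filter]
  refine Finset.sum_congr ?_ fun _ _ => rfl
  ext d
  simp only [Finset.mem_filter, Finset.mem_Ioc, Finset.mem_Icc]
  have hy0 : 0 ≤ (x : ℝ) ^ (1 - η) := Real.rpow_nonneg (Nat.cast_nonneg x) _
  have hyx : (x : ℝ) ^ (1 - η) ≤ x := by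
    rcases Nat.eq_zero_or_pos x with rfl | hx
    · simp [Real.zero_rpow (by linarith : (1 : ℝ) - η ≠ 0)] 
    · exact Real.rpow_le_self_of_one_le (by exact_mod_cast hx) (by linarith)
  constructor
  · rintro ⟨⟨h0, -⟩, hdy⟩
    exact ⟨h0, Nat.le_floor hdy⟩
  · rintro ⟨h1, hdf⟩
    have hdy : (d : ℝ) ≤ (x : ℝ) ^ (1 - η) := (Nat.le_floor_iff hy0).mp hdf
    exact ⟨⟨h1, by exact_mod_cast hdy.trans hyx⟩, hdy⟩

/-- The rounding error is at most `x^{1-η} · log x`. [folklore] -/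
theorem abs_roundingError_le (η : ℝ) (x : ℕ) :
    |∑ d ∈ Finset.Ioc 0 x, (if (d : ℝ) ≤ (x : ℝ) ^ (1 - η) then (moebius d : ℝ) * Real.log d else 0)
        * ((x : ℝ) / d - ((x / d : ℕ) : ℝ))| ≤ (x : ℝ) ^ (1 - η) * Real.log x := by
  have hy0 : 0 ≤ (x : ℝ) ^ (1 - η) := Real.rpow_nonneg (Nat.cast_nonneg x) _
  calc _ ≤ ∑ d ∈ Finset.Ioc 0 x, |(if (d : ℝ) ≤ (x : ℝ) ^ (1 - η) then (moebius d : ℝ) * Real.log d else 0)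
        * ((x : ℝ) / d - ((x / d : ℕ) : ℝ))| := Finset.abs_sum_le_sum_abs _ _
    _ ≤ ∑ d ∈ Finset.Ioc 0 x, (if (d : ℝ) ≤ (x : ℝ) ^ (1 - η) then Real.log x else 0) := by
        refine Finset.sum_le_sum fun d hd => ?_
        obtain ⟨hd0, hdx⟩ := Finset.mem_Ioc.mp hd
        have hd0' : (0 : ℝ) < d := by exact_mod_cast hd0
        -- the fractional part of `x/d` lies in `[0, 1)`
        have hfrac0 : 0 ≤ (x : ℝ) / d - ((x / d : ℕ) : ℝ) := by
          rw [sub_nonneg]; exact Nat.cast_div_le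
        have hfrac1 : (x : ℝ) / d - ((x / d : ℕ) : ℝ) ≤ 1 := by
          rw [sub_le_iff_le_add, ← Nat.floor_div_eq_div (K := ℝ)]
          have := Nat.lt_floor_add_one ((x : ℝ) / d)
          linarith
        split_ifs with h
        · rw [abs_mul, abs_of_nonneg hfrac0]
          have hμ : |(moebius d : ℝ)| ≤ 1 := by exact_mod_cast abs_moebius_le_one
          have hlogd : 0 ≤ Real.log d := Real.log_nonneg (by exact_mod_cast hd0)
          have hlogx : Real.log d ≤ Real.log x :=
            Real.log_le_log hd0' (by exact_mod_cast hdx)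
          calc |(moebius d : ℝ) * Real.log d| * ((x : ℝ) / d - ((x / d : ℕ) : ℝ))
              ≤ |(moebius d : ℝ) * Real.log d| * 1 :=
                mul_le_mul_of_nonneg_left hfrac1 (abs_nonneg _)
            _ = |(moebius d : ℝ)| * Real.log d := by rw [mul_one, abs_mul, abs_of_nonneg hlogd]
            _ ≤ 1 * Real.log x := mul_le_mul hμ hlogx hlogd zero_le_one
            _ = Real.log x := one_mul _
        · simp
    _ = (((Finset.Ioc 0 x).filter fun d : ℕ => (d : ℝ) ≤ (x : ℝ) ^ (1 - η)).card : ℝ) * Real.log x := by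
        rw [← Finset.sum_filter, Finset.sum_const, nsmul_eq_mul]
    _ ≤ (x : ℝ) ^ (1 - η) * Real.log x := by
        refine mul_le_mul_of_nonneg_right ?_ (Real.log_natCast_nonneg x)
        have hsub : ((Finset.Ioc 0 x).filter fun d : ℕ => (d : ℝ) ≤ (x : ℝ) ^ (1 - η))
            ⊆ Finset.Icc 1 ⌊(x : ℝ) ^ (1 - η)⌋₊ := by
          intro d hd
          simp only [Finset.mem_filter, Finset.mem_Ioc, Finset.mem_Icc] at hd ⊢
          exact ⟨hd.1.1, Nat.le_floor hd.2⟩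
        calc (((Finset.Ioc 0 x).filter fun d : ℕ => (d : ℝ) ≤ (x : ℝ) ^ (1 - η)).card : ℝ)
            ≤ ((Finset.Icc 1 ⌊(x : ℝ) ^ (1 - η)⌋₊).card : ℝ) := by exact_mod_cast Finset.card_le_card hsub
          _ = (⌊(x : ℝ) ^ (1 - η)⌋₊ : ℝ) := by simp
          _ ≤ (x : ℝ) ^ (1 - η) := Nat.floor_le hy0

/-- **The crux holds on the prime-number-theorem slice `f = (X)`, for EVERY `η ∈ (0,1)`** (small-model
fact): `Tail_η(x) = -(ψ(x) - x) - x·(1 + ∑_{d ≤ x^{1-η}} μ(d) log d/d) + O(x^{1-η} log x) = o(x)` by the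
prime number theorem (`Literature.NumberTheory.LFunctions.chebyshevPsi_isEquivalent_holds`) and Landau's
`∑ μ(d) log d / d = -1` (`Literature.NumberTheory.LFunctions.tendsto_sum_moebius_mul_log_div`). [folklore] -/
theorem tail_X_isLittleO {η : ℝ} (hη0 : 0 < η) (hη1 : η < 1) :
    (fun x : ℕ => ∑ n ∈ Finset.Icc 1 x,
        ∑ d ∈ Fintype.piFinset (fun i => (((![(X : ℤ[X])] i).eval (n : ℤ)).toNat).divisors),
          if (x : ℝ) ^ (1 - η) < ∏ i, (d i : ℝ) then ∏ i, ((moebius (d i) : ℝ) * Real.log (d i)) else 0)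
      =o[atTop] (fun x : ℕ => (x : ℝ)) := by
  -- T1: ψ(x) - x = o(x)
  have T1 : (fun x : ℕ => Chebyshev.psi x - x) =o[atTop] (fun x : ℕ => (x : ℝ)) :=
    (Literature.NumberTheory.LFunctions.chebyshevPsi_isEquivalent_holds.isLittleO).comp_tendsto
      tendsto_natCast_atTop_atTop
  -- T2: x · (1 + partial sum up to ⌊x^{1-η}⌋) = o(x)
  have hfloor : Tendsto (fun x : ℕ => ⌊(x : ℝ) ^ (1 - η)⌋₊) atTop atTop :=
    tendsto_nat_floor_atTop.comp ((tendsto_rpow_atTop (by linarith)).comp tendsto_natCast_atTop_atTop)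
  have hL : Tendsto (fun x : ℕ => 1 + ∑ d ∈ Finset.Icc 1 ⌊(x : ℝ) ^ (1 - η)⌋₊,
      (moebius d : ℝ) * Real.log d / d) atTop (nhds 0) := by
    have := (Literature.NumberTheory.LFunctions.tendsto_sum_moebius_mul_log_div.comp hfloor).const_add 1
    simpa using this
  have T2 : (fun x : ℕ => (x : ℝ) * (1 + ∑ d ∈ Finset.Icc 1 ⌊(x : ℝ) ^ (1 - η)⌋₊,
      (moebius d : ℝ) * Real.log d / d)) =o[atTop] (fun x : ℕ => (x : ℝ)) := by
    have h := (isBigO_refl (fun x : ℕ => (x : ℝ)) atTop).mul_isLittleO ((isLittleO_one_iff ℝ).mpr hL)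
    simpa using h
  -- T3: the rounding error is O(x^{1-η} log x) = o(x)
  have T3' : (fun x : ℝ => x ^ (1 - η) * Real.log x) =o[atTop] (fun x : ℝ => x) := by
    have h := (isBigO_refl (fun x : ℝ => x ^ (1 - η)) atTop).mul_isLittleO (isLittleO_log_rpow_atTop hη0)
    refine h.congr' EventuallyEq.rfl ?_
    filter_upwards [eventually_gt_atTop (0 : ℝ)] with x hx
    rw [← Real.rpow_add hx, sub_add_cancel, Real.rpow_one]
  have T3 : (fun x : ℕ => ∑ d ∈ Finset.Ioc 0 x, (if (d : ℝ) ≤ (x : ℝ) ^ (1 - η) then (moebius d : ℝ) * Real.log d else 0)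
        * ((x : ℝ) / d - ((x / d : ℕ) : ℝ))) =o[atTop] (fun x : ℕ => (x : ℝ)) := by
    refine IsBigO.trans_isLittleO ?_ (T3'.comp_tendsto tendsto_natCast_atTop_atTop)
    refine IsBigO.of_bound 1 (Eventually.of_forall fun x => ?_)
    rw [one_mul, Real.norm_eq_abs, Function.comp_apply, Real.norm_eq_abs]
    exact (abs_roundingError_le η x).trans (le_abs_self _)
  -- assemble
  have h := (T1.neg_left.sub T2).add T3
  refine h.congr' (Eventually.of_forall fun x => ?_) EventuallyEq.rfl
  beta_reduce
  rw [tail_X_eq η x, sum_Ioc_ite_eq_sum_Icc_floor hη0.le hη1 x]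
  ring

end Summit.Parity.BatemanHorn.Theorems.PolyMobiusTail.Negative
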